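import Mathlib
import HarnessLib
import Summits.Ventures.LatticeQCDFlow.Exactness.NCMCGeneralSpaceTauIntWindowConsistency
import Summits.Ventures.LatticeQCDFlow.Exactness.NCMCGeneralSpaceRestartChainEveryStart
import Summits.Ventures.LatticeQCDFlow.Exactness.SampleESS

/-!
# The Jarzynski lane along CORRELATED starts, dictionary: the CLT variance of `ΔF̂_n` is `2 τ_int(ρ_w) (1/ESS_F − 1)`, and the printed `τ̂` of the weight series converges to `τ_int(ρ_w)` from EVERY initial record law

HONEST FRAMING: exact (Metropolis-corrected) sampling algorithms for lattice gauge theory;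
figures of merit are autocorrelation/cost numbers at stated couplings and volumes; no
continuum-physics claim.

Venture `LatticeQCDFlow` (cell pub-lqcd), topic `Exactness`; FANOUT row 13 (`eng-snf`, GEN-22).
NEW WORK of the cell, not a published result; no definition is introduced; nothing is cited as a
fact.  `NCMCGeneralSpaceRestartChainCLT.lean` (GEN-22) gives `√n (ΔF̂_n − ΔF) ⇒ N(0, σ²_w/(Z₁/Z₀)²)`
along the restart chain `R = (κF ∘ₖ K).comap s`, `σ²_w` the Green–Kubo variance of the weights
`w = e^{−W}`.  This file reads that variance in the two numbers the engine prints for the lane —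
the Kish fraction `ESS_F/n` (`1/ESS_F = E_F[e^{−2(W−ΔF)}]`, GEN-10/12) and the integrated
autocorrelation time of the weight SERIES (`tau_int` of the `ess` column's input, scorer A's
`tauIntWindow ∘ rhoHat`) — and proves the printed `τ̂` consistent for it: GEN-12's independent-launch
variance `1/ESS_F − 1` is inflated by exactly `2 τ_int(ρ_w)`, `ρ_w(t) = C_w̄(t)/C_w̄(0)` the
autocorrelation function of the weights along THIS chain (GEN-16's finite-`n` statement
`NCMCGeneralSpaceStationaryRestartChain.variance_sampleMean_exp_neg_work_restartChain` had
`2 τ_n(ρ_w)`; here the `n → ∞` law and the estimator).  Inputs: GEN-20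
`chain_tauIntWindow_tendstoInMeasure_of_nHit` on the one-step-minorised restart kernel (GEN-18
`CrooksPair.restartKernel_nHit_one_minorised`), `CrooksPair.integral_exp_neg_work`, algebra.

## Content (Crooks pair between finite weights, `Z₀ ≠ 0`, `e^{−ΔF} = Z₁/Z₀`; `−B ≤ W`;
## `K` Markov, `ν₀`-invariant, `m ≤ K(z, ·)` ∀ `z`, `m` finite non-zero; `P_F = fwdPathLaw ν₀ κF`;
## `w̄ = e^{−W} − Z₁/Z₀`, `C_w̄(t) = Scoring.autocov R P_F w̄ t`, `ρ_w(t) = C_w̄(t)/C_w̄(0)`)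

* `CrooksPair.autocov_exp_neg_work_zero_eq` — `C_w̄(0) = (Z₁/Z₀)² (E_F[e^{−2(W−ΔF)}] − 1)`
  (`= (Z₁/Z₀)² (1/ESS_F − 1)`).
* **`CrooksPair.jarzynskiCLTVariance_eq_two_mul_tauInt`** — `C_w̄(0) ≠ 0`:
  `σ²_w / (Z₁/Z₀)² = 2 · Scoring.tauInt ρ_w · (E_F[e^{−2(W−ΔF)}] − 1)`.
* **`CrooksPair.tauIntWindow_exp_neg_work_tendstoInMeasure_restartChain`** — `C_w̄(0) > 0`,
  windows `W_n → ∞`, `W_n³/n → 0`: from EVERY initial record law the printed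
  `tauIntWindow (rhoHat (w ∘ ω) n) (W_n) → Scoring.tauInt ρ_w` in probability; `…_everyStart`.
* `gammaHat_zero_div_sampleMean_sq_eq` — THE SAMPLE IDENTITY, every series with `Σ w ≠ 0`:
  `Γ̂_n(0) / Ȳ_n² = 1/ESŜ_n − 1` (`ESŜ_n = essHat`, the printed Kish FRACTION); hence
  `gammaInterval_halfWidth_eq`: the printed half-width `z √(Γ̂_n(0) · 2 τ̂ / n) / Ȳ_n` IS
  `z √(2 τ̂ (1/ESŜ_n − 1) / n)` — GEN-13's independent-launch plug-in bar `err_n = √((1/ESŜ_n − 1)/n)`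
  (`NCMCGeneralSpaceStudentizedCLT`) times `√(2 τ̂)`.

Reading (value-free): along `n` correlated launches the honest large-`n` error bar of `dF` is
`√(2 τ_int(ρ_w) (1/ESS_F − 1) / n)`, and the run's own `τ̂` of the weight series estimates the
inflation factor consistently.  NOT CLAIMED: `τ_int(ρ_w) ≥ 1/2` or any bound on it (the restart
kernel is not reversible in general); unbounded work; anything numerical.
-/

namespace Summit.Ventures.LatticeQCDFlow.Exactness.GeneralNCMC

open MeasureTheory ProbabilityTheory Set Filter Finset
open scoped ENNReal Topology

variable {Ω E : Type*} [MeasurableSpace Ω] [MeasurableSpace E]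

namespace CrooksPair

variable {ν₀ ν₁ : Measure Ω} [IsFiniteMeasure ν₀] [IsFiniteMeasure ν₁] {κF κR : Kernel Ω E}
  [IsMarkovKernel κF] [IsMarkovKernel κR] {s e : E → Ω} {W : E → ℝ}

/-! ## §1 The lag-zero autocovariance of the weights is `(Z₁/Z₀)² (1/ESS_F − 1)` -/

omit [IsFiniteMeasure ν₁] in
/-- **`C_w̄(0) = (Z₁/Z₀)² (E_F[e^{−2(W−ΔF)}] − 1)`**: the variance of the Jarzynski weight under `P_F`
in the dissipation form (`E_F[e^{−2(W−ΔF)}] = 1/ESS_F`), for bounded-below work and ANY kernel `R`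
(the lag-zero autocovariance does not see the kernel). -/
theorem autocov_exp_neg_work_zero_eq (R : Kernel E E) (h0 : ν₀ univ ≠ 0)
    (h : CrooksPair ν₀ ν₁ κF κR s e W) {ΔF : ℝ}
    (hΔF : Real.exp (-ΔF) = ((ν₀ univ)⁻¹ * ν₁ univ).toReal) {B : ℝ} (hB : ∀ ω, -B ≤ W ω) :
    Scoring.autocov R (fwdPathLaw ν₀ κF)
        (fun ω => Real.exp (-W ω) - ((ν₀ univ)⁻¹ * ν₁ univ).toReal) 0
      = ((ν₀ univ)⁻¹ * ν₁ univ).toReal ^ 2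
        * (∫ ω, Real.exp (-2 * (W ω - ΔF)) ∂(fwdPathLaw ν₀ κF) - 1) := by
  haveI := isProbabilityMeasure_fwdPathLaw ν₀ h0 κF
  set P := fwdPathLaw ν₀ κF with hP
  set θ : ℝ := ((ν₀ univ)⁻¹ * ν₁ univ).toReal with hθ
  have hθpos : 0 < θ := by rw [← hΔF]; exact Real.exp_pos _
  have hwm : Measurable fun ε => Real.exp (-W ε) := Real.measurable_exp.comp h.measurable_W.neg
  have hC : ∀ ω, |Real.exp (-W ω)| ≤ Real.exp B := fun ω => by
    rw [abs_of_pos (Real.exp_pos _)]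
    exact Real.exp_le_exp.2 (by linarith [hB ω])
  have hθi : ∫ z, Real.exp (-W z) ∂P = θ := h.integral_exp_neg_work
  have hi1 : Integrable (fun ω => Real.exp (-W ω)) P := Scoring.integrable_of_bounded P hwm hC
  have hi2 : Integrable (fun ω => Real.exp (-W ω) ^ 2) P :=
    Scoring.integrable_of_bounded P (hwm.pow_const 2) (C := Real.exp B ^ 2) fun ω => by
      rw [abs_pow]; exact pow_le_pow_left₀ (abs_nonneg _) (hC ω) 2
  -- the square of the weight in the dissipation form
  have hsq : ∀ ω, Real.exp (-2 * (W ω - ΔF)) = Real.exp (-W ω) ^ 2 / θ ^ 2 := fun ω => by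
    rw [← hΔF, ← Real.exp_nat_mul, ← Real.exp_nat_mul, ← Real.exp_sub]
    congr 1
    push_cast
    ring
  have hint2 : ∫ ω, Real.exp (-2 * (W ω - ΔF)) ∂P = (∫ ω, Real.exp (-W ω) ^ 2 ∂P) / θ ^ 2 := by
    simp_rw [hsq]
    rw [integral_div]
  unfold Scoring.autocov
  simp only [Function.iterate_zero, id_eq]
  have hexp : (fun ω => (Real.exp (-W ω) - θ) * (Real.exp (-W ω) - θ))
      = fun ω => Real.exp (-W ω) ^ 2 - (2 * θ) * Real.exp (-W ω) + θ ^ 2 := by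
    funext ω; ring
  have i12 : Integrable (fun ω => Real.exp (-W ω) ^ 2 - (2 * θ) * Real.exp (-W ω)) P :=
    hi2.sub (hi1.const_mul _)
  have i3 : Integrable (fun _ : E => θ ^ 2) P := integrable_const _
  have himul : Integrable (fun ω => (2 * θ) * Real.exp (-W ω)) P := hi1.const_mul _
  rw [hexp, integral_add i12 i3, integral_sub hi2 himul, integral_const_mul, integral_const,
    probReal_univ, one_smul, hθi, hint2]
  field_simp
  ring

/-! ## §2 The CLT variance of `ΔF̂_n` is `2 τ_int(ρ_w) (1/ESS_F − 1)` -/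

omit [IsFiniteMeasure ν₁] in
/-- **`σ²_w / (Z₁/Z₀)² = 2 τ_int(ρ_w) (E_F[e^{−2(W−ΔF)}] − 1)`**: the asymptotic variance of
`√n (ΔF̂_n − ΔF)` along the restart chain (`NCMCGeneralSpaceRestartChainCLT`) is GEN-12's
independent-launch figure `1/ESS_F − 1` inflated by twice the integrated autocorrelation time of
the weight series along the chain, `ρ_w(t) = C_w̄(t)/C_w̄(0)` (`C_w̄(0) ≠ 0`). -/
theorem jarzynskiCLTVariance_eq_two_mul_tauInt (R : Kernel E E) (h0 : ν₀ univ ≠ 0)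
    (h : CrooksPair ν₀ ν₁ κF κR s e W) {ΔF : ℝ}
    (hΔF : Real.exp (-ΔF) = ((ν₀ univ)⁻¹ * ν₁ univ).toReal) {B : ℝ} (hB : ∀ ω, -B ≤ W ω)
    (ha0 : Scoring.autocov R (fwdPathLaw ν₀ κF)
        (fun ω => Real.exp (-W ω) - ((ν₀ univ)⁻¹ * ν₁ univ).toReal) 0 ≠ 0) :
    (Scoring.autocov R (fwdPathLaw ν₀ κF)
          (fun ω => Real.exp (-W ω) - ((ν₀ univ)⁻¹ * ν₁ univ).toReal) 0
        + 2 * ∑' t, Scoring.autocov R (fwdPathLaw ν₀ κF)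
          (fun ω => Real.exp (-W ω) - ((ν₀ univ)⁻¹ * ν₁ univ).toReal) (t + 1))
        / ((ν₀ univ)⁻¹ * ν₁ univ).toReal ^ 2
      = 2 * Scoring.tauInt (fun t => Scoring.autocov R (fwdPathLaw ν₀ κF)
            (fun ω => Real.exp (-W ω) - ((ν₀ univ)⁻¹ * ν₁ univ).toReal) t
          / Scoring.autocov R (fwdPathLaw ν₀ κF)
            (fun ω => Real.exp (-W ω) - ((ν₀ univ)⁻¹ * ν₁ univ).toReal) 0)
        * (∫ ω, Real.exp (-2 * (W ω - ΔF)) ∂(fwdPathLaw ν₀ κF) - 1) := by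
  set θ : ℝ := ((ν₀ univ)⁻¹ * ν₁ univ).toReal with hθ
  have hθpos : 0 < θ := by rw [← hΔF]; exact Real.exp_pos _
  set a0 := Scoring.autocov R (fwdPathLaw ν₀ κF) (fun ω => Real.exp (-W ω) - θ) 0 with ha0def
  have hD : ∫ ω, Real.exp (-2 * (W ω - ΔF)) ∂(fwdPathLaw ν₀ κF) - 1 = a0 / θ ^ 2 := by
    have h1 := h.autocov_exp_neg_work_zero_eq R h0 hΔF hB
    rw [← hθ, ← ha0def] at h1
    rw [h1]
    field_simp
  -- `σ² = 2 a0 τ`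
  have hτ : a0 + 2 * ∑' t, Scoring.autocov R (fwdPathLaw ν₀ κF) (fun ω => Real.exp (-W ω) - θ) (t + 1)
      = 2 * a0 * Scoring.tauInt
        (fun t => Scoring.autocov R (fwdPathLaw ν₀ κF) (fun ω => Real.exp (-W ω) - θ) t / a0) := by
    unfold Scoring.tauInt
    rw [tsum_div_const]
    field_simp
  rw [hD, hτ]
  field_simp

/-! ## §3 The printed `τ̂` of the weight series is consistent along the restart chain -/

omit [IsFiniteMeasure ν₁] in
/-- **THE PRINTED `τ̂` OF THE WEIGHTS CONVERGES TO `τ_int(ρ_w)` FROM EVERY INITIAL RECORD LAW.**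
Crooks pair with `Z₀ ≠ 0`; `−B ≤ W`; `K` Markov, `ν₀`-invariant, `m ≤ K(z, ·)` for all `z` (`m`
finite, `m(Ω) ≠ 0`); `C_w̄(0) > 0` (the weight is not `P_F`-a.s. constant); windows `W_n → ∞`,
`W_n³/n → 0`.  Then scorer A's `tauIntWindow (rhoHat (e^{−W(ω_·)}) n) (W_n) → Scoring.tauInt ρ_w` in
probability under the chain law of the records from `μ₀`. -/
theorem tauIntWindow_exp_neg_work_tendstoInMeasure_restartChain (K : Kernel Ω Ω) [IsMarkovKernel K]
    (h0 : ν₀ univ ≠ 0) (hK : Kernel.Invariant K ν₀) (h : CrooksPair ν₀ ν₁ κF κR s e W)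
    {m : Measure Ω} [IsFiniteMeasure m] (hm0 : m univ ≠ 0) (hmin : ∀ z, m ≤ K z)
    {B : ℝ} (hB : ∀ ω, -B ≤ W ω)
    (ha0 : 0 < Scoring.autocov ((κF ∘ₖ K).comap s h.measurable_s) (fwdPathLaw ν₀ κF)
        (fun ω => Real.exp (-W ω) - ((ν₀ univ)⁻¹ * ν₁ univ).toReal) 0)
    {Wn : ℕ → ℕ} (hW : Tendsto Wn atTop atTop)
    (hW3 : Tendsto (fun n => (Wn n : ℝ) ^ 3 / n) atTop (𝓝 0))
    (μ₀ : Measure E) [IsProbabilityMeasure μ₀] :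
    TendstoInMeasure (Kernel.trajMeasure (X := fun _ : ℕ => E) μ₀
        (fun n : ℕ => ((κF ∘ₖ K).comap s h.measurable_s).comap
          (fun hh : (j : ↥(Finset.Iic n)) → E => hh ⟨n, Finset.mem_Iic.2 le_rfl⟩)
          (measurable_pi_apply _)))
      (fun (n : ℕ) (ω : ℕ → E) =>
        Scoring.tauIntWindow (Scoring.rhoHat (fun i => Real.exp (-W (ω i))) n) (Wn n))
      atTop (fun _ => Scoring.tauInt (fun t =>
        Scoring.autocov ((κF ∘ₖ K).comap s h.measurable_s) (fwdPathLaw ν₀ κF)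
            (fun ω => Real.exp (-W ω) - ((ν₀ univ)⁻¹ * ν₁ univ).toReal) t
          / Scoring.autocov ((κF ∘ₖ K).comap s h.measurable_s) (fwdPathLaw ν₀ κF)
            (fun ω => Real.exp (-W ω) - ((ν₀ univ)⁻¹ * ν₁ univ).toReal) 0)) := by
  haveI := isProbabilityMeasure_fwdPathLaw ν₀ h0 κF
  haveI := isProbabilityMeasure_normalised_bind_kernel κF hm0
  set R := (κF ∘ₖ K).comap s h.measurable_s with hR
  set θ : ℝ := ((ν₀ univ)⁻¹ * ν₁ univ).toReal with hθ
  have hθi : ∫ z, Real.exp (-W z) ∂(fwdPathLaw ν₀ κF) = θ := h.integral_exp_neg_work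
  have hwm : Measurable fun ε => Real.exp (-W ε) := Real.measurable_exp.comp h.measurable_W.neg
  have hC : ∀ ω, |Real.exp (-W ω)| ≤ Real.exp B := fun ω => by
    rw [abs_of_pos (Real.exp_pos _)]
    exact Real.exp_le_exp.2 (by linarith [hB ω])
  have ha0' : 0 < Scoring.autocov R (fwdPathLaw ν₀ κF)
      (fun ω => Real.exp (-W ω) - ∫ z, Real.exp (-W z) ∂(fwdPathLaw ν₀ κF)) 0 := by
    rw [hθi]; exact ha0
  have key := chain_tauIntWindow_tendstoInMeasure_of_nHit (μ₀ := μ₀) (h.invariant_restartKernel K hK)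
    hm0 (restartKernel_nHit_one_minorised K h hm0 hmin) Nat.one_pos hwm hC ha0' hW hW3
  rw [hθi] at key
  set a0 := Scoring.autocov R (fwdPathLaw ν₀ κF) (fun ω => Real.exp (-W ω) - θ) 0 with ha0def
  -- `σ²/(2 a0) = τ_int(ρ_w)`
  have hτ : (a0 + 2 * ∑' t, Scoring.autocov R (fwdPathLaw ν₀ κF) (fun ω => Real.exp (-W ω) - θ) (t + 1))
        / (2 * a0)
      = Scoring.tauInt
        (fun t => Scoring.autocov R (fwdPathLaw ν₀ κF) (fun ω => Real.exp (-W ω) - θ) t / a0) := by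
    have ha0ne : a0 ≠ 0 := ha0.ne'
    unfold Scoring.tauInt
    rw [tsum_div_const]
    field_simp
  rw [hτ] at key
  exact key

omit [IsFiniteMeasure ν₁] in
/-- **… from EVERY initial configuration** (`μ₀ = κF(x, ·)`: the engine's form). -/
theorem tauIntWindow_exp_neg_work_tendstoInMeasure_restartChain_everyStart (K : Kernel Ω Ω)
    [IsMarkovKernel K] (h0 : ν₀ univ ≠ 0) (hK : Kernel.Invariant K ν₀)
    (h : CrooksPair ν₀ ν₁ κF κR s e W) {m : Measure Ω} [IsFiniteMeasure m] (hm0 : m univ ≠ 0)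
    (hmin : ∀ z, m ≤ K z) {B : ℝ} (hB : ∀ ω, -B ≤ W ω)
    (ha0 : 0 < Scoring.autocov ((κF ∘ₖ K).comap s h.measurable_s) (fwdPathLaw ν₀ κF)
        (fun ω => Real.exp (-W ω) - ((ν₀ univ)⁻¹ * ν₁ univ).toReal) 0)
    {Wn : ℕ → ℕ} (hW : Tendsto Wn atTop atTop)
    (hW3 : Tendsto (fun n => (Wn n : ℝ) ^ 3 / n) atTop (𝓝 0)) (x : Ω) :
    TendstoInMeasure (Kernel.trajMeasure (X := fun _ : ℕ => E) (κF x)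
        (fun n : ℕ => ((κF ∘ₖ K).comap s h.measurable_s).comap
          (fun hh : (j : ↥(Finset.Iic n)) → E => hh ⟨n, Finset.mem_Iic.2 le_rfl⟩)
          (measurable_pi_apply _)))
      (fun (n : ℕ) (ω : ℕ → E) =>
        Scoring.tauIntWindow (Scoring.rhoHat (fun i => Real.exp (-W (ω i))) n) (Wn n))
      atTop (fun _ => Scoring.tauInt (fun t =>
        Scoring.autocov ((κF ∘ₖ K).comap s h.measurable_s) (fwdPathLaw ν₀ κF)
            (fun ω => Real.exp (-W ω) - ((ν₀ univ)⁻¹ * ν₁ univ).toReal) t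
          / Scoring.autocov ((κF ∘ₖ K).comap s h.measurable_s) (fwdPathLaw ν₀ κF)
            (fun ω => Real.exp (-W ω) - ((ν₀ univ)⁻¹ * ν₁ univ).toReal) 0)) :=
  h.tauIntWindow_exp_neg_work_tendstoInMeasure_restartChain K h0 hK hm0 hmin hB ha0 hW hW3 (κF x)

end CrooksPair

/-! ## §4 The printed half-width in terms of the printed Kish fraction: an exact sample identity -/

/-- **`Γ̂_n(0) / Ȳ_n² = 1/ESŜ_n − 1`** for every finite series of weights with `Σ w ≠ 0` (`n ≥ 1`):
scorer A's lag-zero autocovariance over the squared sample mean is the printed Kish fraction's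
`1/ESŜ − 1` (`essHat w = (Σ w)²/(n Σ w²)`). -/
theorem gammaHat_zero_div_sampleMean_sq_eq {E : Type*} (w : E → ℝ) (ω : ℕ → E) {n : ℕ} (hn : n ≠ 0)
    (hS : ∑ i ∈ range n, w (ω i) ≠ 0) :
    Scoring.gammaHat (fun i => w (ω i)) n 0 / sampleMean w (fun i : Fin n => ω i) ^ 2
      = 1 / essHat (fun i : Fin n => w (ω i)) - 1 := by
  have hn' : (n : ℝ) ≠ 0 := by exact_mod_cast hn
  unfold essHat sampleMean
  rw [Fintype.card_fin, Fin.sum_univ_eq_sum_range (fun i => w (ω i)) n,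
    Fin.sum_univ_eq_sum_range (fun i => w (ω i) ^ 2) n, Scoring.gammaHat_zero,
    Scoring.acovSum_zero_eq]
  simp only [Scoring.dev, Scoring.sampleMean]
  have hexp : ∑ i ∈ range n, (w (ω i) - (∑ i ∈ range n, w (ω i)) / n) ^ 2
      = ∑ i ∈ range n, w (ω i) ^ 2 - (∑ i ∈ range n, w (ω i)) ^ 2 / n := by
    have h1 : ∀ i, (w (ω i) - (∑ i ∈ range n, w (ω i)) / n) ^ 2
        = w (ω i) ^ 2 - 2 * ((∑ i ∈ range n, w (ω i)) / n) * w (ω i)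
          + ((∑ i ∈ range n, w (ω i)) / n) ^ 2 := fun i => by ring
    simp_rw [h1]
    rw [sum_add_distrib, sum_sub_distrib, ← mul_sum, sum_const, card_range, nsmul_eq_mul]
    field_simp
    ring
  have hS2 : ∑ i ∈ range n, w (ω i) ^ 2 ≠ 0 := by
    intro h0
    have hall : ∀ i ∈ range n, w (ω i) = 0 := fun i hi => by
      have := (sum_eq_zero_iff_of_nonneg fun j _ => sq_nonneg (w (ω j))).1 h0 i hi
      exact pow_eq_zero_iff (n := 2) (by norm_num) |>.1 this
    exact hS (sum_eq_zero hall)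
  rw [hexp]
  field_simp

/-- **The printed half-width IS `z √(2 τ̂ (1/ESŜ_n − 1)/n)`**: for `n ≥ 1`, a positive mean weight and
any `τ̂`, `z`: `z √(Γ̂_n(0) · 2 τ̂ / n) / Ȳ_n = z √(2 τ̂ (1/ESŜ_n − 1) / n)`. -/
theorem gammaInterval_halfWidth_eq {E : Type*} (w : E → ℝ) (ω : ℕ → E) {n : ℕ} (hn : n ≠ 0)
    (hY : 0 < sampleMean w (fun i : Fin n => ω i)) (τ z : ℝ) :
    z * Real.sqrt (Scoring.gammaHat (fun i => w (ω i)) n 0 * (2 * τ) / n)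
        / sampleMean w (fun i : Fin n => ω i)
      = z * Real.sqrt (2 * τ * (1 / essHat (fun i : Fin n => w (ω i)) - 1) / n) := by
  have hS : ∑ i ∈ range n, w (ω i) ≠ 0 := by
    intro h0
    have : sampleMean w (fun i : Fin n => ω i) = 0 := by
      unfold sampleMean
      rw [Fin.sum_univ_eq_sum_range (fun i => w (ω i)) n, h0, zero_div]
    exact hY.ne' this
  rw [← gammaHat_zero_div_sampleMean_sq_eq w ω hn hS, mul_div_assoc]
  congr 1
  rw [← Real.sqrt_sq hY.le, ← Real.sqrt_div' _ (sq_nonneg _), Real.sqrt_sq hY.le]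
  congr 1
  field_simp

end Summit.Ventures.LatticeQCDFlow.Exactness.GeneralNCMC
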